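import Summits.QuantumFields.YangMills.Theorems.WeakCouplingMasslessPhaseDeconfinedIsMasslessNotPerimeterOfCentreUnbroken
import Summits.QuantumFields.YangMills.Theorems.WeakCouplingMasslessPhaseDeconfinedIsMasslessStrongCouplingCentre
import HarnessLib

/-!
# Crux `DeconfinedIsMassless` (stmt-QuantumFields-19521): stub A at strong coupling ∘ stub B —
# no perimeter law in any torus limit state of `SU(N)₄` for `0 < β < 1/(108 · r.N)`

Helper file (`--supports stmt-QuantumFields-19521`, closes nothing) of the PORT lane `ym-lit-19521-confcrit` (g1).
Composition of the two landed halves of the birth line at strong coupling: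

* stub A's conclusion on the window `108 · r.N · |β| < 1` at every width
  (`slabCentre_inlined_of_strongCoupling`, file `…DeconfinedIsMasslessStrongCouplingCentre.lean`: Dobrushin uniqueness of
  the slab theory, Literature `CentreSymmetryDobrushin.lean`), and
* stub B (`stub_not_perimeter_of_centreUnbroken`, file `…DeconfinedIsMasslessNotPerimeterOfCentreUnbroken.lean`:
  Chatterjee 2021 Thm. 2.2 in torus-primary form),

give `not_hasPerimeterLaw_of_strongCoupling`: for `N ≥ 2`, every lattice representation `r` of `SU(N)` and
`0 < β < 1/(108 · r.N)`, NO infinite-volume torus limit state of the four-dimensional `r`-Wilson theory has a perimeter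
law for the normalised fundamental Wilson loop — confinement at strong coupling by the centre-symmetry mechanism (the
tree's Osterwalder–Seiler area law `osterwalder_seiler_areaLaw_holds` is the cluster-expansion proof of a stronger
statement on its own window). Consequently the crux implication `DeconfinedIsMassless` is vacuously true on this window
(`deconfinedIsMassless_shape_of_strongCoupling`: its perimeter-law hypothesis fails, torus limit states being non-empty),
exactly as the tribunal record of the route anticipated (T1 F6 / J r1: «K1b vacuous at strong coupling»). Nothing here
bears on the open large-`β` content of stub A.

Sources: S. Chatterjee, CMP 385 (2021), arXiv:2006.16229, Def. 2.1, Thm. 2.2; H.-O. Georgii (2011) Thm. 8.20.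
-/

set_option autoImplicit false

noncomputable section

namespace Summit.QuantumFields.YangMills.Theorems.DeconfinedIsMassless

open MeasureTheory Filter Topology
open Literature.Probability.LatticeModels
open Literature.MathematicalPhysics
open Literature.MathematicalPhysics.QuantumLattice

variable {N : ℕ}

/-- **No perimeter law at strong coupling (`SU(N)₄`, every faithful unitary lattice action).** For `N ≥ 2`, a lattice
representation `r` of `SU(N)`, `0 < β` and `108 · r.N · β < 1`, no `μ ∈ infiniteVolumeLimitPoints (d := 4) r.ρ β` has a
perimeter law for `g ↦ (1/N) Re tr g`: stub A's conclusion holds at width `1` (`slabCentre_inlined_of_strongCoupling`)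
and stub B (`stub_not_perimeter_of_centreUnbroken`, Chatterjee 2021 Thm. 2.2) converts it.
[cite: Chatterjee2021, Thm. 2.2 with Def. 2.1] -/
theorem not_hasPerimeterLaw_of_strongCoupling (hN : 2 ≤ N)
    (r : QuantumFieldTheory.LatticeRep (Matrix.specialUnitaryGroup (Fin N) ℂ)) {β : ℝ} (hβ : 0 < β)
    (hsmall : 108 * (r.N : ℝ) * β < 1) {μ : Measure (LGConfig 4 (Matrix.specialUnitaryGroup (Fin N) ℂ))}
    (hμ : μ ∈ infiniteVolumeLimitPoints (d := 4) r.ρ β) :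
    ¬ HasPerimeterLaw μ (fun g => normalisedCharacter N (fundamentalRep (Fin N) g)) := by
  have hβ' : 108 * (r.N : ℝ) * |β| < 1 := by rwa [abs_of_pos hβ]
  exact stub_not_perimeter_of_centreUnbroken N hN r β hβ
    ⟨1, le_rfl, slabCentre_inlined_of_strongCoupling r β hβ' 1 le_rfl⟩ μ hμ

/-- **The crux implication holds (vacuously) on the strong-coupling window.** For `N ≥ 2`, every `r`, EVERY pair of
species `A, B` and every `β` with `0 < β`, `108 · r.N · β < 1`: «all torus limit states have the fundamental perimeter
law» ⇒ anything (in particular ⇒ «no uniform clustering of `A, B`»), because a torus limit state exists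
(`infiniteVolumeLimitPoints_nonempty_holds`) and has no perimeter law (`not_hasPerimeterLaw_of_strongCoupling`). This is
the body of `DeconfinedIsMassless` at such `β`; the crux itself quantifies over all `β > 0`. [cite: Chatterjee2021, Thm. 2.2 with Def. 2.1] -/
theorem deconfinedIsMassless_shape_of_strongCoupling (hN : 2 ≤ N)
    (r : QuantumFieldTheory.LatticeRep (Matrix.specialUnitaryGroup (Fin N) ℂ))
    (A B : QuantumFieldTheory.YMSpecies (Matrix.specialUnitaryGroup (Fin N) ℂ)) {β : ℝ} (hβ : 0 < β)
    (hsmall : 108 * (r.N : ℝ) * β < 1)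
    (hper : ∀ μ ∈ infiniteVolumeLimitPoints (d := 4) r.ρ β,
      HasPerimeterLaw μ (fun g => normalisedCharacter N (fundamentalRep (Fin N) g))) :
    ¬ ∃ (C m : ℝ) (S₀ : ℕ), 0 < m ∧ ∀ S : ℕ, S₀ ≤ S → ∀ n : ℕ, n ≤ S →
      |QuantumFieldTheory.latticeConnectedCorr r.ρ β (2 * S + 1) A.F B.F n| ≤ C * Real.exp (-(m * n)) := by
  intro _
  obtain ⟨μ, hμ⟩ := infiniteVolumeLimitPoints_nonempty_holds (d := 4) r.ρ r.continuous β
  exact not_hasPerimeterLaw_of_strongCoupling hN r hβ hsmall hμ (hper μ hμ)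

end Summit.QuantumFields.YangMills.Theorems.DeconfinedIsMassless

end
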